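import Summits.QuantumFields.YangMills.Theorems.DiagonalMirrorRPRWilsonDiagonalModel

/-!
# Crux `DiagonalMirrorRPR` (stmt-QuantumFields-10604), line `sign-twisted-diagonal-trace`, construction F1_diag
# (director-ym O4 WORD 3 (A)): the two HALF STEPS of the diagonal step, and the `Fin`-indexed cyclic trace

Helper for the crux `DiagonalMirrorRPR` of `YangMills` (routes `IsotropyFromPowerCounting`, `MirrorModularBoosts`,
`PencilRigidity`; item stmt-QuantumFields-10604), attached `--supports … --as helper`; it closes nothing by itself.
Continuation of `…Theorems.DiagonalMirrorRPRWilsonDiagonalModelDefs` / `…WilsonDiagonalModel` (layers `Z_v : LayerCfg`, step table `stepPlaq`,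
step action, two-step kernel `stepKernel ρ β`, `diagCyclicTrace`).

* §6 HALF LAYERS AND HALF STEPS.  A layer `Z_v` is the pair (bond half `Y_{v−½} = bonds Z_v`, in-slab half
  `X_v = inslab Z_v`) (`HalfCfg`, `glue`, `bonds_glue`, `inslab_glue`, `glue_bonds_inslab`).  The step action splits as
  **`stepAction ρ Z Z' = evenAction ρ Y X Y' + oddAction ρ X Y' X'`** (`stepAction_eq_even_add_odd`,
  `stepKernel_eq_even_mul_odd`): the EVEN half step (window `Y, X, Y'`: the `(0,1)` diamonds coupling the two bond layers
  around slab `v`, plus the in-slab `(2,3)` plaquettes) and the ODD half step (window `X, Y', X'`: the `(0,2),(0,3)`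
  plaquettes based in slab `v` and the `(1,2),(1,3)` plaquettes based in slab `v+1`).  This is the lattice form of the
  card's "one `e₀`-step of the slab state is a product of two Markov half steps 𝒜 (site slab) and 𝓑 (link slab)"
  (`WrongSignAnnex.step_eq_hat_mul_hat`, `Cruxes/DiagonalMirrorRPR/SketchSeat2Annex.lean`): the diagonal chain in
  half-integer time `…, Y_{v−½}, X_v, Y_{v+½}, X_{v+1}, …` has range-one interactions, the two-step kernel `K = exp(β·even)·
  exp(β·odd)` is their composition, and it is NOT symmetric because the two half steps differ.
* §7 `diagCyclicTrace_eq_integral_fin` — the cyclic trace re-indexed over `Fin m` with `Fin` addition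
  (`∫ ∏_{t : Fin m} K(V t, V (t+1)) dHaar^{⊗m}`), the convention of the tree's trace formulas
  (`Literature/Analysis/OperatorTheory/{KernelCyclicPeeling, PositiveKernelSpectralTrace, HermitianKernelSpectralTrace}`).

OWED (unchanged): the swap-induced label involution `Θ` on the odd torus (fibrewise only in the chart `u = x₀ + x₁`,
which needs `S` odd), the positive type of the Θ-twisted even weight for `β ≥ 0`, the self-adjoint realisation
`A = Ê^{1/2} Ô Ê^{1/2}` with its Hilbert–Schmidt bound and trace formulas, and the `famObs` pairing layer — hence no
`def wilsonDiagonalModel : DiagonalSliceModel r sch` yet.  HONEST FRAMING: a construction helper; nothing about D_old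
⟨10604⟩, the RP crux of the FOLD restate, or the summit is proved; the Yang–Mills mass gap is NOT proved here or anywhere
in the tree.

References: K. Osterwalder, E. Seiler, Ann. Phys. 110 (1978) §2–3; E. Seiler, LNP 159 (1982) Ch. 2.
-/

set_option autoImplicit false

noncomputable section

open MeasureTheory
open Literature.MathematicalPhysics.QuantumLattice Literature.MathematicalPhysics.QuantumFieldTheory
open Summit.QuantumFields.YangMills.Cruxes.DiagonalMirrorRPR.ParityBridgeColdTraces

namespace Summit.QuantumFields.YangMills.Cruxes.DiagonalMirrorRPR.SignTwistedDiagonalTrace.WilsonDiagonal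

/-! ## §6 The two half steps of one diagonal step: the `(01)`-cut (even) and the slab coupling (odd) -/

section HalfSteps

variable {n₁ N : ℕ}

/-- Configurations of a HALF layer: two link labels per slab site — either the bond half `Y` (label `0` = arriving
`e₀`-bond, `1` = leaving `e₁`-bond) or the in-slab half `X` (label `0` = direction `2`, `1` = direction `3`). -/
abbrev HalfCfg (n₁ N : ℕ) (G : Type*) : Type _ := SlabSite n₁ N × Fin 2 → G

variable {G : Type*}

/-- The bond half `Y_{v−½}` of a layer `Z_v` (labels `0, 1`). -/
def bonds (Z : LayerCfg n₁ N G) : HalfCfg n₁ N G := fun p => Z (p.1, ![(0 : Fin 4), 1] p.2)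

/-- The in-slab half `X_v` of a layer `Z_v` (labels `2, 3`). -/
def inslab (Z : LayerCfg n₁ N G) : HalfCfg n₁ N G := fun p => Z (p.1, ![(2 : Fin 4), 3] p.2)

/-- Gluing a bond half and an in-slab half into a layer. -/
def glue (Y X : HalfCfg n₁ N G) : LayerCfg n₁ N G := fun p =>
  if h : (p.2 : ℕ) < 2 then Y (p.1, ⟨p.2, h⟩) else X (p.1, ⟨(p.2 : ℕ) - 2, by omega⟩)

/-- `bonds (glue Y X) = Y`. -/
theorem bonds_glue (Y X : HalfCfg n₁ N G) : bonds (glue Y X) = Y := by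
  funext ⟨s, i⟩
  fin_cases i <;> simp [bonds, glue]

/-- `inslab (glue Y X) = X`. -/
theorem inslab_glue (Y X : HalfCfg n₁ N G) : inslab (glue Y X) = X := by
  funext ⟨s, i⟩
  fin_cases i <;> simp [inslab, glue]

/-- `glue (bonds Z) (inslab Z) = Z`. -/
theorem glue_bonds_inslab (Z : LayerCfg n₁ N G) : glue (bonds Z) (inslab Z) = Z := by
  funext ⟨s, i⟩
  fin_cases i <;> simp [bonds, inslab, glue]

variable [NeZero n₁] [NeZero N] [Group G] {Nc : ℕ} (ρ : G →* Matrix (Fin Nc) (Fin Nc) ℂ)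

/-- **The even half step** (the `(01)`-cut, window `Y_{v−½}, X_v, Y_{v+½}`): the `(0,1)` plaquettes — diamonds
`Y'(s,0) Y'(s,1) Y(s+ê₁,0)⁻¹ Y(s,1)⁻¹` coupling the two bond layers around slab `v` — plus the in-slab `(2,3)`
plaquettes of `X_v`.  For `β ≥ 0` its Boltzmann weight, twisted by the swap-induced label involution, is a kernel of
positive type (`exp(β Re tr ρ(g h⁻¹))` is positive definite); that operator-level statement is OWED. -/
def evenAction (Y X Y' : HalfCfg n₁ N G) : ℝ :=
  ∑ s : SlabSite n₁ N,
    ((ρ (Y' (s, 0) * Y' (s, 1) * (Y (s + slabStep 1, 0))⁻¹ * (Y (s, 1))⁻¹)).trace.re +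
      (ρ (X (s, 0) * X (s + slabStep 2, 1) * (X (s + slabStep 3, 0))⁻¹ * (X (s, 1))⁻¹)).trace.re)

/-- **The odd half step** (the slab coupling, window `X_v, Y_{v+½}, X_{v+1}`): the `(0,2),(0,3)` plaquettes based
in slab `v` and the `(1,2),(1,3)` plaquettes based in slab `v+1` — the in-slab links of two consecutive slabs coupled
through the bond layer between them.  Its weight is NOT of positive type (the wrong-sign sector lives here). -/
def oddAction (X Y' X' : HalfCfg n₁ N G) : ℝ :=
  ∑ s : SlabSite n₁ N,
    ((ρ (Y' (s, 0) * X' (s, 0) * (Y' (s + slabStep 2, 0))⁻¹ * (X (s, 0))⁻¹)).trace.re +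
      (ρ (Y' (s, 0) * X' (s, 1) * (Y' (s + slabStep 3, 0))⁻¹ * (X (s, 1))⁻¹)).trace.re +
      (ρ (Y' (s, 1) * X (s + slabStep 1, 0) * (Y' (s + slabStep 2, 1))⁻¹ * (X' (s, 0))⁻¹)).trace.re +
      (ρ (Y' (s, 1) * X (s + slabStep 1, 1) * (Y' (s + slabStep 3, 1))⁻¹ * (X' (s, 1))⁻¹)).trace.re)

/-- **One diagonal step = even half step + odd half step**:
`stepAction ρ Z Z' = evenAction ρ Y X Y' + oddAction ρ X Y' X'` with `Z = (Y, X)`, `Z' = (Y', X')`. -/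
theorem stepAction_eq_even_add_odd (Z Z' : LayerCfg n₁ N G) :
    stepAction ρ Z Z' = evenAction ρ (bonds Z) (inslab Z) (bonds Z') + oddAction ρ (inslab Z) (bonds Z') (inslab Z') := by
  unfold stepAction evenAction oddAction
  rw [← Finset.sum_add_distrib]
  refine Finset.sum_congr rfl fun s _ => ?_
  rw [sum_fin4_lt]
  simp only [stepPlaq, bonds, inslab, Matrix.cons_val_zero, Matrix.cons_val_one, Matrix.cons_val]
  ring

/-- **The two-step kernel is the product of the two half-step weights**:
`K(Z, Z') = exp(β · even(Y, X, Y')) · exp(β · odd(X, Y', X'))`. -/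
theorem stepKernel_eq_even_mul_odd (β : ℝ) (Z Z' : LayerCfg n₁ N G) :
    stepKernel ρ β Z Z' = Real.exp (β * evenAction ρ (bonds Z) (inslab Z) (bonds Z')) *
      Real.exp (β * oddAction ρ (inslab Z) (bonds Z') (inslab Z')) := by
  rw [stepKernel, stepAction_eq_even_add_odd, mul_add, Real.exp_add]

end HalfSteps

/-! ## §7 The cyclic trace over `Fin m` (the convention of `Literature/Analysis/OperatorTheory/*CyclicPeeling`) -/

section FinCyclic

variable {n₁ N : ℕ} [NeZero n₁] [NeZero N]
variable {G : Type} [Group G] [TopologicalSpace G] [IsTopologicalGroup G] [CompactSpace G] [MeasurableSpace G]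
  [BorelSpace G] {Nc : ℕ} (ρ : G →* Matrix (Fin Nc) (Fin Nc) ℂ) (β : ℝ)

/-- **The cyclic trace as a `Fin m`-indexed periodic path integral** (`Fin` addition, last factor `K(V (m−1), V 0)`):
`diagCyclicTrace ρ β m n₁ N = ∫ ∏_{t : Fin m} K(V t, V (t+1)) dHaar^{⊗m}` — the shape consumed by the tree's trace
formulas (`KernelCyclicPeeling`, `PositiveKernelSpectralTrace`, `HermitianKernelSpectralTrace`). -/
theorem diagCyclicTrace_eq_integral_fin (m : ℕ) [NeZero m] :
    diagCyclicTrace ρ β m n₁ N (G := G) =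
      ∫ V : Fin m → LayerCfg n₁ N G, ∏ t : Fin m, stepKernel ρ β (V t) (V (t + 1))
        ∂(Measure.pi fun _ : Fin m => layerHaar n₁ N G) := by
  -- reindex `ZMod m ≃ Fin m` additively
  set e : ZMod m ≃+* Fin m := (ZMod.finEquiv m).symm with he
  haveI : SigmaFinite (layerHaar n₁ N G) := by unfold layerHaar; infer_instance
  have hmp : MeasurePreserving
      (MeasurableEquiv.piCongrLeft (fun _ : ZMod m => LayerCfg n₁ N G) e.toEquiv.symm)
      (Measure.pi fun _ : Fin m => layerHaar n₁ N G) (Measure.pi fun _ : ZMod m => layerHaar n₁ N G) :=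
    measurePreserving_piCongrLeft (μ := fun _ : ZMod m => layerHaar n₁ N G) e.toEquiv.symm
  unfold diagCyclicTrace
  rw [← hmp.integral_comp']
  refine integral_congr_ae (ae_of_all _ fun V => ?_)
  simp only [MeasurableEquiv.coe_piCongrLeft, Equiv.piCongrLeft_apply_eq_cast, cast_eq, Equiv.symm_symm,
    RingEquiv.toEquiv_eq_coe, EquivLike.coe_coe]
  refine Fintype.prod_equiv e.toEquiv _ _ fun t => ?_
  simp only [RingEquiv.toEquiv_eq_coe, EquivLike.coe_coe, map_add, map_one]

end FinCyclic

end Summit.QuantumFields.YangMills.Cruxes.DiagonalMirrorRPR.SignTwistedDiagonalTrace.WilsonDiagonal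

end
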